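import Summits.BirchSwinnertonDyer.BirchSwinnertonDyer.Theorems.ErratumRoadFiveNonSurjCornerTwinRubin
import Summits.BirchSwinnertonDyer.Rank1Residual.X11b.Three.CornerResidual
import Summits.BirchSwinnertonDyer.Rank1Residual.X11b.TwistTransportRam
import Literature.NumberTheory.EllipticCurves.LFunctionSmulProofs
import Literature.NumberTheory.EllipticCurves.ComplexMultiplication

/-!
# Route `ClassRecordThree` (rung K2@3), crux 7 `CornerAtThree` (item 19111), conjunct (Tw)
# `Three.CornerTwistAt`: the Kato half of the rank-0 twin's `BSD(3)` is PRINT on the Euler-unit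
# locus — Rubin 1998 Thm. 8.7 + Wuthrich 2014 Cor. 18 + the rank-0 engine at `p = 3` — modulo `μ = 0`
# (cell `bsd-stepL`, seat `bsd-stepL-corner-p1` g4; `--supports stmt-BirchSwinnertonDyer-19111`)

Item 19111 `CornerAtThree := ∀ W, Three.CornerStepLAt W ∧ Three.CornerTwistAt W ∧ Three.CornerUpperAt W`.
Its conjunct (Tw) `Three.CornerTwistAt W` asks for the FULL `BSD(E^{d_K}, 3)` (`BSDp Wd 3`) of every
odd-`d_K` Heegner twin `Wd = Cd • E^{(d_K)}` of a non-surjective X11b pair `(E, 3)` with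
`L(E^{(d_K)}, 1) ≠ 0`. The p ≥ 5 work of this seat (`Theorems/ErratumRoadFiveNonSurjCornerTwin*.lean`,
p453738 ∕ p454452 ∕ p456176 ∕ p463251) is prime-generic: the rank-`0` ENGINE
`missingUpperBoundAt_of_multDivisibilityAt_of_analyticRank_eq_zero` (any odd multiplicative `p`) and the
citation theorem `multDivisibilityAt_of_thm87_of_corollary18_of_eulerUnit_of_mu_eq_zero` (Rubin 1998
Thm. 8.7, no image hypothesis, `N`-imprimitive + Wuthrich 2014 Cor. 18 + Euler-unit certificate +
`μ = 0`, any odd multiplicative `p`). THIS FILE reads them at a rank-`0` multiplicative pair and at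
`p = 3`:

* §1 `missingUpperBoundAt_of_thm87_of_corollary18_of_eulerUnit_of_mu_eq_zero` — at ANY globally minimal
  `W` of analytic rank `0` with `p ≠ 2` multiplicative: the Kato half `Typed.MissingUpperBoundAt W p`
  from the two named facts + the Euler-unit certificate + `μ(X(E/ℚ_∞)) = 0` (hypothesis shape) +
  the engine's PUBLISHED inputs (SW13 Thm. 6.1 ×2, GZK, modularity ×2, Greenberg–Stevens).
* §2 `missingUpperBoundAt_heegnerTwist_of_thm87_…` — the same at the Heegner twin `Wd = Cd • E^{(d_K)}`
  of a curve `E` multiplicative at `p` (`K` imaginary quadratic with the Heegner hypothesis for `N_E`,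
  `L(E^{(d_K)},1) ≠ 0`): `Wd` is multiplicative at `p` (`hasMultiplicativeReductionAtPrime_twist_of_heegner'`)
  and of analytic rank `0` (`analyticRank_smul`, `analyticRank_eq_zero_of_entireLFunction_one_ne_zero`).
* §3 (`p = 3`) `bsdp_three_heegnerTwist_of_lower_of_thm87_…` — `BSDp Wd 3` from §2 + the OTHER half
  `Typed.MissingLowerBoundAt Wd 3` (the main-conjecture ∕ Eisenstein side at the twin — the object of
  cruxes 19107 `HalvesAtThree` ∕ 19109 at the twin, hypothesis shape here);
  **`cornerTwistAt_of_thm87_of_lowerTwists_of_eulerUnitOrUpper_of_mu_eq_zero`** — conjunct (Tw) of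
  19111 for `W` ⟸ the two named facts + engine pubs + [lower half at every odd Heegner twin] +
  [`μ = 0` at every twin WITH an Euler-unit certificate] + [the Kato half `MissingUpperBoundAt Wd 3`
  ONLY at twins WITHOUT a certificate].

READING. On (T4″)@3 the twin summand (Tw) splits exactly as at `p ≥ 5`: its Euler-system half is
print (Thm. 8.7 + Cor. 18) + `μ = 0` on the Euler-unit locus (no multiplicative `q ≠ 3` of `E` with
`q ≡ a_q (mod 3)`, i.e. no split `q ≡ 1` and no non-split `q ≡ 2 (mod 3)` — at `p = 3` this is a
STRONG restriction: every multiplicative `q ∤ 6` has `q ≡ ±1 (mod 3)`, so the certificate holds iff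
every multiplicative `q ≠ 3` of `E` is split with `q ≡ 2` or non-split with `q ≡ 1 (mod 3)`, or `q = 2`
non-split), its other half is the route's IMC side at the twin.

HONEST FRAMING. Theorems only (no `def`); `h87`, `h18` are NAMED Literature facts (p460044, p460048;
D-0014); `hμ`, `hlow`, `hoff` are hypothesis SHAPES; nothing here proves `μ = 0`, a lower half or any
pair's `BSD(3)`; item 19111 does NOT close (its other conjuncts `CornerStepLAt`, `CornerUpperAt` are
untouched); no census word moves; BSD is not proved by any of this.

References: [Rubin1998Durham] Thm. 8.7; [Wuthrich2014] Cor. 18 (p. 398); [SteinWuthrich2013] Thm. 6.1;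
[GreenbergStevens1993]; [Miller2011LMS] Def. 1.1; [SilvermanAEC2009] VII.5 Prop. 5.1(b), X.5 Cor. 5.4;
tree: `Theorems/ErratumRoadFiveNonSurjCornerTwinKatoEngine.lean`, `…TwinRubin.lean`,
`X11b/Three/CornerResidual.lean`, `X11b/TwistTransportRam.lean`.
-/

noncomputable section

open scoped Classical NumberField MatrixGroups ModularForm

namespace Summit.BirchSwinnertonDyer.Rank1Residual.X11b

open CongruenceSubgroup WeierstrassCurve NumberField IsDedekindDomain Field
  Literature.NumberTheory.EllipticCurves
  Literature.NumberTheory.EllipticCurves.ModularForms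
  Literature.NumberTheory.EllipticCurves.Rank1Residual
  Literature.NumberTheory.EllipticCurves.Rank1Residual.Typed
  Literature.NumberTheory.EllipticCurves.Wuthrich2014
  Literature.NumberTheory.EllipticCurves.Rubin1998
  Literature.NumberTheory.EllipticCurves.SteinWuthrich2013
  Literature.NumberTheory.EllipticCurves.GreenbergVatsal2000
  Summit.BirchSwinnertonDyer.Rank1Residual
  Summit.BirchSwinnertonDyer.Rank1Residual.X11b.Three

/-! ### §0 The Heegner twin has analytic rank `0` -/

/-- A globally minimal model `Wd = Cd • E^{(d_K)}` of the twist with `L(E^{(d_K)}, 1) ≠ 0` has analytic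
rank `0` (`analyticRank_smul`; `analyticRank_eq_zero_of_entireLFunction_one_ne_zero`). [folklore] -/
theorem analyticRank_heegnerTwist_eq_zero (W : WeierstrassCurve ℚ) [W.IsElliptic]
    (K : Type) [Field K] [NumberField K]
    (hLt : (W.quadraticTwist (NumberField.discr K : ℚ)).entireLFunction 1 ≠ 0)
    {Wd : WeierstrassCurve ℚ} (Cd : VariableChange ℚ)
    (hWd : Cd • W.quadraticTwist (NumberField.discr K : ℚ) = Wd) : Wd.analyticRank = 0 := by
  have hD0 : (NumberField.discr K : ℚ) ≠ 0 := by exact_mod_cast NumberField.discr_ne_zero K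
  haveI : (W.quadraticTwist (NumberField.discr K : ℚ)).IsElliptic := W.isElliptic_quadraticTwist hD0
  rw [← hWd, analyticRank_smul]
  exact analyticRank_eq_zero_of_entireLFunction_one_ne_zero _ hLt

/-! ### §1 The Kato half at a rank-0 multiplicative pair, by citation on the Euler-unit locus -/

/-- **`Typed.MissingUpperBoundAt W p` at a rank-`0` pair with `p ≠ 2` multiplicative, from Rubin 1998
Thm. 8.7 + Wuthrich 2014 Cor. 18 + the Euler-unit certificate + `μ = 0`** (composition of
`multDivisibilityAt_of_thm87_of_corollary18_of_eulerUnit_of_mu_eq_zero` with the rank-`0` engine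
`missingUpperBoundAt_of_multDivisibilityAt_of_analyticRank_eq_zero`). PUBLISHED binders: `hJs`, `hJn`
(Stein–Wuthrich 2013 Thm. 6.1), `hGZK`, `hmod`, `hpar`, `hGS` (Greenberg–Stevens), `h87`, `h18`.
Certificate: `S ∌ (p)` a finite set of places containing the bad places `≠ p` with
`(∏_{v∈S} 𝒫_v)(0) ∈ ℤ_p^×`. CONDITIONAL on `hμ` (`μ(X(E/ℚ_∞)) = 0` for every cyclotomic dual datum,
rung K6's object); nothing booked. [cite: Rubin1998Durham, Thm. 8.7] [cite: Wuthrich2014, Cor. 18 (p. 398)]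
[cite: SteinWuthrich2013, Thm. 6.1 (p. 20)] [cite: Miller2011LMS, Def. 1.1] -/
theorem missingUpperBoundAt_of_thm87_of_corollary18_of_eulerUnit_of_mu_eq_zero
    (hJs : thm61_splitMultiplicative) (hJn : thm61_nonsplitMultiplicative)
    (hGZK : rank_eq_analyticRank_of_analyticRank_le_one) (hmod : hasEntireLFunction_rat)
    (hpar : nonempty_modularParametrizationData)
    (h87 : Rubin1998.thm87_charIdeal_dvd_imprimitive_multiplicative)
    (h18 : Wuthrich2014.corollary18_padicLFunction_mem_iwasawaAlgebra_multiplicative)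
    (W : WeierstrassCurve ℚ) [W.IsElliptic] [W.IsGloballyMinimal] (p : ℕ) [Fact p.Prime]
    (hGS : greenberg_stevens (W := W) (p := p))
    (hp : p ≠ 2) (hmult : W.HasMultiplicativeReductionAtPrime p) (hr : W.analyticRank = 0)
    (S : Finset (HeightOneSpectrum (𝓞 ℚ)))
    (hS : ∀ v : HeightOneSpectrum (𝓞 ℚ), ¬ W.HasGoodReductionAt v →
      Rat.HeightOneSpectrum.natGenerator v ≠ p → v ∈ S)
    (hSp : ∀ v ∈ S, Rat.HeightOneSpectrum.natGenerator v ≠ p)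
    (hEU : IsUnit (PowerSeries.constantCoeff (eulerFactorProduct W p S)))
    (hμ : ∀ (κ : ZpExtension ℚ p) (γ : Field.absoluteGaloisGroup ℚ),
      κ.IsCyclotomic → κ.IsTopGenerator γ → IsCyclotomicVariable p γ →
      ∀ D : W.SelmerDualData κ γ, D.mu = 0) :
    Typed.MissingUpperBoundAt W p :=
  missingUpperBoundAt_of_multDivisibilityAt_of_analyticRank_eq_zero hJs hJn hGZK hmod hpar W p hGS hp
    hmult hr
    (multDivisibilityAt_of_thm87_of_corollary18_of_eulerUnit_of_mu_eq_zero h87 h18 W p hp hmult S hS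
      hSp hEU hμ)

/-! ### §2 At the Heegner twin of a curve multiplicative at `p` -/

/-- **The Kato half at the rank-`0` Heegner twin `Wd = Cd • E^{(d_K)}`** of a curve `E` with `p ≠ 2`
multiplicative, `K` imaginary quadratic satisfying the Heegner hypothesis for `N_E`, `L(E^{(d_K)},1) ≠ 0`:
`Wd` is multiplicative at `p` (`d_K` is a square in `ℚ_p`: `hasMultiplicativeReductionAtPrime_twist_of_heegner'`)
and of analytic rank `0`, so §1 applies at `(Wd, p)` with the certificate and `μ = 0` read on `Wd`.
CONDITIONAL on `hμ`; nothing booked. [cite: Rubin1998Durham, Thm. 8.7] [cite: Wuthrich2014, Cor. 18 (p. 398)]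
[cite: SilvermanAEC2009, VII.5 Prop. 5.1(b) and X.5 Cor. 5.4] [cite: Miller2011LMS, Def. 1.1] -/
theorem missingUpperBoundAt_heegnerTwist_of_thm87_of_corollary18_of_eulerUnit_of_mu_eq_zero
    (hJs : thm61_splitMultiplicative) (hJn : thm61_nonsplitMultiplicative)
    (hGZK : rank_eq_analyticRank_of_analyticRank_le_one) (hmod : hasEntireLFunction_rat)
    (hpar : nonempty_modularParametrizationData)
    (hGS : ∀ (W : WeierstrassCurve ℚ) [W.IsElliptic] [W.IsGloballyMinimal] (p : ℕ) [Fact p.Prime],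
      greenberg_stevens (W := W) (p := p))
    (h87 : Rubin1998.thm87_charIdeal_dvd_imprimitive_multiplicative)
    (h18 : Wuthrich2014.corollary18_padicLFunction_mem_iwasawaAlgebra_multiplicative)
    (W : WeierstrassCurve ℚ) [W.IsElliptic] (p : ℕ) [Fact p.Prime]
    (hp : p ≠ 2) (hmult : W.HasMultiplicativeReductionAtPrime p)
    (K : Type) [Field K] [NumberField K] (hK : IsImaginaryQuadratic K)
    (hHN : SatisfiesHeegnerHypothesis (W.conductorNorm ℤ) K)
    (hLt : (W.quadraticTwist (NumberField.discr K : ℚ)).entireLFunction 1 ≠ 0)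
    (Wd : WeierstrassCurve ℚ) [Wd.IsElliptic] [Wd.IsGloballyMinimal] (Cd : VariableChange ℚ)
    (hWd : Cd • W.quadraticTwist (NumberField.discr K : ℚ) = Wd)
    (S : Finset (HeightOneSpectrum (𝓞 ℚ)))
    (hS : ∀ v : HeightOneSpectrum (𝓞 ℚ), ¬ Wd.HasGoodReductionAt v →
      Rat.HeightOneSpectrum.natGenerator v ≠ p → v ∈ S)
    (hSp : ∀ v ∈ S, Rat.HeightOneSpectrum.natGenerator v ≠ p)
    (hEU : IsUnit (PowerSeries.constantCoeff (eulerFactorProduct Wd p S)))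
    (hμ : ∀ (κ : ZpExtension ℚ p) (γ : Field.absoluteGaloisGroup ℚ),
      κ.IsCyclotomic → κ.IsTopGenerator γ → IsCyclotomicVariable p γ →
      ∀ D : Wd.SelmerDualData κ γ, D.mu = 0) :
    Typed.MissingUpperBoundAt Wd p := by
  have hmultd : Wd.HasMultiplicativeReductionAtPrime p :=
    hasMultiplicativeReductionAtPrime_twist_of_heegner' W p K hK hHN hmult Cd hWd
  have hrd : Wd.analyticRank = 0 := analyticRank_heegnerTwist_eq_zero W K hLt Cd hWd
  exact missingUpperBoundAt_of_thm87_of_corollary18_of_eulerUnit_of_mu_eq_zero hJs hJn hGZK hmod hpar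
    h87 h18 Wd p (hGS Wd p) hp hmultd hrd S hS hSp hEU hμ

/-! ### §3 `p = 3`: conjunct (Tw) `Three.CornerTwistAt` of item 19111 -/

/-- **`BSD(E^{(d_K)}, 3)` at an odd Heegner twin of a pair `(E, 3)` with `3` multiplicative, from the
Kato half of §2 (Thm. 8.7 + Cor. 18 + certificate + `μ = 0`) and the OTHER half
`Typed.MissingLowerBoundAt Wd 3`** (the main-conjecture ∕ Eisenstein side at the rank-`0` twin — the
route's cruxes at the twin; hypothesis shape `hlow`): the two halves give `Typed.MissingPPartAt Wd 3`
(`missingPPartAt_of_lower_of_upper`), whence `BSDp Wd 3` in analytic rank `0`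
(`bsdp_of_missingPPartAt`, GZK). CONDITIONAL on `hlow`, `hμ`; nothing booked.
[cite: Rubin1998Durham, Thm. 8.7] [cite: Wuthrich2014, Cor. 18 (p. 398)] [cite: Miller2011LMS, §1 and Def. 1.1] -/
theorem bsdp_three_heegnerTwist_of_lower_of_thm87_of_corollary18_of_eulerUnit_of_mu_eq_zero
    (hJs : thm61_splitMultiplicative) (hJn : thm61_nonsplitMultiplicative)
    (hGZK : rank_eq_analyticRank_of_analyticRank_le_one) (hmod : hasEntireLFunction_rat)
    (hpar : nonempty_modularParametrizationData)
    (hGS : ∀ (W : WeierstrassCurve ℚ) [W.IsElliptic] [W.IsGloballyMinimal] (p : ℕ) [Fact p.Prime],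
      greenberg_stevens (W := W) (p := p))
    (h87 : Rubin1998.thm87_charIdeal_dvd_imprimitive_multiplicative)
    (h18 : Wuthrich2014.corollary18_padicLFunction_mem_iwasawaAlgebra_multiplicative)
    (W : WeierstrassCurve ℚ) [W.IsElliptic] (hmult : W.HasMultiplicativeReductionAtPrime 3)
    (K : Type) [Field K] [NumberField K] (hK : IsImaginaryQuadratic K)
    (hHN : SatisfiesHeegnerHypothesis (W.conductorNorm ℤ) K)
    (hLt : (W.quadraticTwist (NumberField.discr K : ℚ)).entireLFunction 1 ≠ 0)
    (Wd : WeierstrassCurve ℚ) [Wd.IsElliptic] [Wd.IsGloballyMinimal] (Cd : VariableChange ℚ)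
    (hWd : Cd • W.quadraticTwist (NumberField.discr K : ℚ) = Wd)
    (S : Finset (HeightOneSpectrum (𝓞 ℚ)))
    (hS : ∀ v : HeightOneSpectrum (𝓞 ℚ), ¬ Wd.HasGoodReductionAt v →
      Rat.HeightOneSpectrum.natGenerator v ≠ 3 → v ∈ S)
    (hSp : ∀ v ∈ S, Rat.HeightOneSpectrum.natGenerator v ≠ 3)
    (hEU : IsUnit (PowerSeries.constantCoeff (eulerFactorProduct Wd 3 S)))
    (hμ : ∀ (κ : ZpExtension ℚ 3) (γ : Field.absoluteGaloisGroup ℚ),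
      κ.IsCyclotomic → κ.IsTopGenerator γ → IsCyclotomicVariable 3 γ →
      ∀ D : Wd.SelmerDualData κ γ, D.mu = 0)
    (hlow : Typed.MissingLowerBoundAt Wd 3) :
    BSDp Wd 3 := by
  have hrd : Wd.analyticRank = 0 := analyticRank_heegnerTwist_eq_zero W K hLt Cd hWd
  have hup : Typed.MissingUpperBoundAt Wd 3 :=
    missingUpperBoundAt_heegnerTwist_of_thm87_of_corollary18_of_eulerUnit_of_mu_eq_zero hJs hJn hGZK hmod
      hpar hGS h87 h18 W 3 (by decide) hmult K hK hHN hLt Wd Cd hWd S hS hSp hEU hμ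
  exact Typed.bsdp_of_missingPPartAt Wd 3 hGZK (by rw [hrd]; exact zero_le_one)
    (Typed.missingPPartAt_of_lower_of_upper Wd 3 hlow hup)

/-- **Conjunct (Tw) `Three.CornerTwistAt W` of crux 7 `CornerAtThree` (item 19111) modulo Rubin 1998
Thm. 8.7 + Wuthrich 2014 Cor. 18 + engine pubs + [the main-conjecture half `MissingLowerBoundAt` at
every odd Heegner twin] + [`μ = 0` at every twin WITH an Euler-unit certificate] + [the Kato half
`MissingUpperBoundAt` ONLY at twins WITHOUT a certificate].** The non-surjective corner at `3`
consumes `BSD(E^{(d_K)},3)` of its rank-`0` twins; this theorem splits that input into its two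
Miller halves and discharges the Euler-system half BY CITATION on the Euler-unit locus of the twins
(`hoff` keeps it as a typed input off that locus), leaving the twin's IMC half (`hlow`) and `μ = 0`
(`hμ`). CONDITIONAL on `hlow`, `hμ`, `hoff`; does NOT close item 19111 (conjuncts `CornerStepLAt`,
`CornerUpperAt` untouched); nothing booked.
[cite: Rubin1998Durham, Thm. 8.7] [cite: Wuthrich2014, Cor. 18 (p. 398)] [cite: SteinWuthrich2013, Thm. 6.1 (p. 20)]
[cite: Miller2011LMS, §1 and Def. 1.1] [cite: GreenbergLNM1716, §1 Conj. 1.11 (shape of μ = 0)] -/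
theorem cornerTwistAt_of_thm87_of_lowerTwists_of_eulerUnitOrUpper_of_mu_eq_zero
    (hJs : thm61_splitMultiplicative) (hJn : thm61_nonsplitMultiplicative)
    (hGZK : rank_eq_analyticRank_of_analyticRank_le_one) (hmod : hasEntireLFunction_rat)
    (hpar : nonempty_modularParametrizationData)
    (hGS : ∀ (W : WeierstrassCurve ℚ) [W.IsElliptic] [W.IsGloballyMinimal] (p : ℕ) [Fact p.Prime],
      greenberg_stevens (W := W) (p := p))
    (h87 : Rubin1998.thm87_charIdeal_dvd_imprimitive_multiplicative)
    (h18 : Wuthrich2014.corollary18_padicLFunction_mem_iwasawaAlgebra_multiplicative)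
    (W : WeierstrassCurve ℚ) [W.IsElliptic] [W.IsGloballyMinimal]
    -- the main-conjecture ∕ Eisenstein half at every odd Heegner twin (route cruxes at the twin; shape)
    (hlow : ∀ (K : Type) [Field K] [NumberField K]
      (Wd : WeierstrassCurve ℚ) [Wd.IsElliptic] [Wd.IsGloballyMinimal] (Cd : VariableChange ℚ),
      ClassX11b W 3 → ¬ Surj W 3 → IsImaginaryQuadratic K → Odd (NumberField.discr K) →
      SatisfiesHeegnerHypothesis (W.conductorNorm ℤ) K →
      (W.quadraticTwist (NumberField.discr K : ℚ)).entireLFunction 1 ≠ 0 →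
      Cd • W.quadraticTwist (NumberField.discr K : ℚ) = Wd → Typed.MissingLowerBoundAt Wd 3)
    -- Greenberg's μ = 0 at every twin carrying an Euler-unit certificate (rung K6's object; shape)
    (hμ : ∀ (K : Type) [Field K] [NumberField K]
      (Wd : WeierstrassCurve ℚ) [Wd.IsElliptic] [Wd.IsGloballyMinimal] (Cd : VariableChange ℚ),
      ClassX11b W 3 → ¬ Surj W 3 → IsImaginaryQuadratic K → Odd (NumberField.discr K) →
      SatisfiesHeegnerHypothesis (W.conductorNorm ℤ) K →
      (W.quadraticTwist (NumberField.discr K : ℚ)).entireLFunction 1 ≠ 0 →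
      Cd • W.quadraticTwist (NumberField.discr K : ℚ) = Wd →
      ∀ (κ : ZpExtension ℚ 3) (γ : Field.absoluteGaloisGroup ℚ),
        κ.IsCyclotomic → κ.IsTopGenerator γ → IsCyclotomicVariable 3 γ →
        ∀ D : Wd.SelmerDualData κ γ, D.mu = 0)
    -- the Kato half as a typed input ONLY at twins WITHOUT an Euler-unit certificate
    (hoff : ∀ (K : Type) [Field K] [NumberField K]
      (Wd : WeierstrassCurve ℚ) [Wd.IsElliptic] [Wd.IsGloballyMinimal] (Cd : VariableChange ℚ),
      ClassX11b W 3 → ¬ Surj W 3 → IsImaginaryQuadratic K → Odd (NumberField.discr K) →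
      SatisfiesHeegnerHypothesis (W.conductorNorm ℤ) K →
      (W.quadraticTwist (NumberField.discr K : ℚ)).entireLFunction 1 ≠ 0 →
      Cd • W.quadraticTwist (NumberField.discr K : ℚ) = Wd →
      (¬ ∃ S : Finset (HeightOneSpectrum (𝓞 ℚ)),
        (∀ v : HeightOneSpectrum (𝓞 ℚ), ¬ Wd.HasGoodReductionAt v →
          Rat.HeightOneSpectrum.natGenerator v ≠ 3 → v ∈ S) ∧
        (∀ v ∈ S, Rat.HeightOneSpectrum.natGenerator v ≠ 3) ∧
        IsUnit (PowerSeries.constantCoeff (eulerFactorProduct Wd 3 S))) →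
      Typed.MissingUpperBoundAt Wd 3) :
    CornerTwistAt W := by
  intro K _ _ Wd _ _ Cd hX hns hK hodd hHN hLt hWd
  have hrd : Wd.analyticRank = 0 := analyticRank_heegnerTwist_eq_zero W K hLt Cd hWd
  have hl : Typed.MissingLowerBoundAt Wd 3 := hlow K Wd Cd hX hns hK hodd hHN hLt hWd
  have hup : Typed.MissingUpperBoundAt Wd 3 := by
    by_cases hcert : ∃ S : Finset (HeightOneSpectrum (𝓞 ℚ)),
        (∀ v : HeightOneSpectrum (𝓞 ℚ), ¬ Wd.HasGoodReductionAt v →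
          Rat.HeightOneSpectrum.natGenerator v ≠ 3 → v ∈ S) ∧
        (∀ v ∈ S, Rat.HeightOneSpectrum.natGenerator v ≠ 3) ∧
        IsUnit (PowerSeries.constantCoeff (eulerFactorProduct Wd 3 S))
    · obtain ⟨S, hS1, hS2, hEU⟩ := hcert
      exact missingUpperBoundAt_heegnerTwist_of_thm87_of_corollary18_of_eulerUnit_of_mu_eq_zero hJs hJn
        hGZK hmod hpar hGS h87 h18 W 3 (by decide) hX.2.2.1 K hK hHN hLt Wd Cd hWd S hS1 hS2 hEU
        (hμ K Wd Cd hX hns hK hodd hHN hLt hWd)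
    · exact hoff K Wd Cd hX hns hK hodd hHN hLt hWd hcert
  exact Typed.bsdp_of_missingPPartAt Wd 3 hGZK (by rw [hrd]; exact zero_le_one)
    (Typed.missingPPartAt_of_lower_of_upper Wd 3 hl hup)

end Summit.BirchSwinnertonDyer.Rank1Residual.X11b

end
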